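/-
Copyright (c) 2026 the pub-hodgecm-mathlib formalisation cell (harness21).  Prover seat hodgecm-mathlib-K2E4-p08 (g2), Track B «K2-LIT» ∕ h413,
‹S› ROAD J brick J2♯, UNRAMIFIED LEAF: the rank-one EP letter with its NEGATIVE central value at every unramified non-split place.  2026-09-03∕04.
-/
import Literature.NumberTheory.Rogawski1990.RankOneEulerPoincareNonsplitUnramifiedAll     -- ★ (E) `epEllipticRelation_of_unramified`, the explicit triple `K, Ad_d K, K ⊓ Ad_d K` (+ ★ (N) `epNonEllipticRelation`)
import Literature.NumberTheory.Rogawski1990.RankOneEulerPoincareGlueCentralValue          -- ★ p855520 (this seat): the glue WITH the (negative) value on `K ⊓ K′ ⊓ I`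
import Literature.MeasureTheory.Group.HaarCosetCountInequality                             -- ★ p855541 (this seat): `hidx` from coset witnesses
import Literature.NumberTheory.Automorphic.UnitaryIwahoriOrbitalIntegralSplitTorus         -- ★ `exists_weylElement_two`, `mem_iff_mem_cmLocalIntegralLevel_and_v_lt_one_of_mem_iff_iwahoriGL`
import Literature.NumberTheory.Automorphic.UnitaryTwoIwahoriEdgeCountCM                     -- ★ the unramified residue data recipe (anti-fixed unit `σa₀ − a₀`)
import Literature.NumberTheory.Rogawski1990.UnitStableOrbitalIntegralHSideValue            -- ★ `valuation_eq_one_of_galAdicCompletionMap_mul_self`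
import Literature.NumberTheory.Automorphic.UnitaryTwoRamifiedTreeStabilizers               -- ★ `mem_glInt_iff_forall_v_le_one_and_v_det_eq_one`
import HarnessLib

/-!
# (R2♯) at the UNRAMIFIED non-split places: Kottwitz's rank-one Euler–Poincaré function with its NEGATIVE value at the central unit scalars — road J brick J2♯, leaf 1

At a finite place `v` of `L⁺` that is inert in the CM field `L` (`w ∣ v` unique, `v` unramified), the quasi-split rank-one unitary group `U(Φ₂)_v`
(`Φ₂ = !![0,1;1,0]`) acts on the Bruhat–Tits tree of `SL₂(L_w)`-type with the two vertex stabilisers `K = U(Φ₂)(𝒪_v)` (★ `cmLocalIntegralLevel`) and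
`K′ = Ad_d K`, `d = diag(1, ϖ)` (★ `cmDatumLocalNonsplitCongr`), meeting in the Iwahori `I = K ⊓ K′`.  Kottwitz's Euler–Poincaré function is the explicit
combination `f_EP = 1_K ∕ vol K + 1_{K′} ∕ vol K′ − 1_I ∕ vol I` ([Kottwitz1988, §2]); its orbital integrals are `1` on regular elliptic classes and `0` on
regular split classes ((E) ★ `epEllipticRelation_of_unramified`, (N) ★ `epNonEllipticRelation`, glued WITH THE VALUE on `K ⊓ K′ ⊓ I` by ★
`exists_isLocSmooth_classOrbitalIntegral_eq_one_zero_and_apply_neg_of_relations`).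

This file supplies the three ONE-PLACE MATRIX FACTS that pin down the SIGN of `f_EP` at the central unit scalars `z = a·1`:
* (W1) `scalar_mem_triple_of_unramified`: `z ∈ K`, `z ∈ K′`, `z ∈ I` (unitarity forces `|a_w|_w = 1`);
* (W2) three pairwise `I`-inequivalent elements of `K`: `1`, the Weyl element `w₀ = Φ₂`, and the lower unipotent `u(t) = !![1,0;t,1]` with an
  anti-fixed unit `t = σ_w a₀ − a₀` (exists because the residual extension is quadratic — ★ `exists_isUnit_map_sub_of_residueHom_ne`);
* (W3) one element of `K′ ∖ K`: the `ϖ`-antidiagonal `!![0,ϖ⁻¹;ϖ,0] = Ad_d(w₀)` ([Serre1980Trees, II.1.1]);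
whence (★ `toReal_inv_add_toReal_inv_lt_of_witnesses`, Haar coset counting) `1∕vol K + 1∕vol K′ < 1∕vol I` and the letter
`exists_isLocSmooth_classOrbitalIntegral_eq_one_zero_and_apply_neg_of_unramified`: **there is a locally constant compactly supported `f` on `U(Φ₂)_v` with
orbital integrals `1 ∕ 0` on the regular elliptic ∕ split classes (canonical measures) and `f(a·1) = −r` for one `r > 0` and every central unit scalar.**
This is the unramified leaf of the input (R2♯) of road J for the signed singular transfer ‹S› ([Rogawski1990, §8.1 p. 117, §12.6 p. 174]: the coefficient of the
singular sheet is read off against `f_EP`, whose central value carries the Kottwitz sign `e(U(Φ₂)_v)`-twisted Euler–Poincaré characteristic, negative in rank one).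

HONEST LABEL: a Literature-side helper toward h413 (`stmt-HodgeConjecture-24833`); HC_CM is proved only modulo its printed citations until rung 0 closes.
-/

set_option autoImplicit false

noncomputable section

open scoped ValuativeRel Matrix MatrixGroups ENNReal
open Matrix NumberField IsDedekindDomain MulAction MeasureTheory Measure

namespace Literature.NumberTheory.Rogawski1990

open Literature.NumberTheory.Automorphic Literature.NumberTheory.Automorphic.UnitaryGroup Literature.NumberTheory.GaloisRepresentations
open Literature.MeasureTheory.Group
open Literature.NumberTheory.Automorphic.HermitianLatticeTree (mem_glInt_iff_forall_v_le_one_and_v_det_eq_one)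


/-! ## §0 One-place matrix algebra: the Weyl element, the anti-fixed lower unipotent, the `ϖ`-antidiagonal -/

section OnePlace

variable {F : Type*} [Field F] (σ : F →+* F)

/-- `J² = 1` for `J = !![0,1;1,0]`. [cite: Rogawski1990, §1.10 p. 9] -/
theorem antidiagTwo_mul_self : (!![(0 : F), 1; 1, 0] : Matrix (Fin 2) (Fin 2) F) * !![(0 : F), 1; 1, 0] = 1 := by
  ext i j; fin_cases i <;> fin_cases j <;> simp

/-- `u(t) u(−t) = 1` for the lower unipotents. [cite: Rogawski1990, §1.10 p. 9] -/
theorem lowerUnipTwo_mul_neg (t : F) : (!![(1 : F), 0; t, 1] : Matrix (Fin 2) (Fin 2) F) * !![(1 : F), 0; -t, 1] = 1 := by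
  ext i j; fin_cases i <;> fin_cases j <;> simp

/-- The `ϖ`-antidiagonal `!![0,ϖ⁻¹;ϖ,0]` is an involution. [cite: Serre1980Trees, II.1.1] -/
theorem piAntidiagTwo_mul_self {ϖ : F} (hϖ : ϖ ≠ 0) :
    (!![(0 : F), ϖ⁻¹; ϖ, 0] : Matrix (Fin 2) (Fin 2) F) * !![(0 : F), ϖ⁻¹; ϖ, 0] = 1 := by
  ext i j; fin_cases i <;> fin_cases j <;> simp [hϖ]

/-- `J` is unitary for `(σ, J)`. [cite: Rogawski1990, §1.10 p. 9] -/
theorem antidiagTwo_unitary :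
    ((!![(0 : F), 1; 1, 0] : Matrix (Fin 2) (Fin 2) F).map σ)ᵀ * !![(0 : F), 1; 1, 0] * !![(0 : F), 1; 1, 0] = !![(0 : F), 1; 1, 0] := by
  ext i j; fin_cases i <;> fin_cases j <;> simp [Matrix.mul_apply, Fin.sum_univ_two]

/-- The lower unipotent `u(t)` is unitary for `(σ, J)` iff `σ t = −t`; here the «if». [cite: Rogawski1990, §1.10 p. 9] -/
theorem lowerUnipTwo_unitary {t : F} (hσt : σ t = -t) :
    ((!![(1 : F), 0; t, 1] : Matrix (Fin 2) (Fin 2) F).map σ)ᵀ * !![(0 : F), 1; 1, 0] * !![(1 : F), 0; t, 1] = !![(0 : F), 1; 1, 0] := by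
  ext i j; fin_cases i <;> fin_cases j <;> simp [Matrix.mul_apply, Fin.sum_univ_two, hσt]

/-- The `ϖ`-antidiagonal is unitary for `(σ, J)` when `σ ϖ = ϖ`. [cite: Serre1980Trees, II.1.1] -/
theorem piAntidiagTwo_unitary {ϖ : F} (hϖ : ϖ ≠ 0) (hσϖ : σ ϖ = ϖ) :
    ((!![(0 : F), ϖ⁻¹; ϖ, 0] : Matrix (Fin 2) (Fin 2) F).map σ)ᵀ * !![(0 : F), 1; 1, 0] * !![(0 : F), ϖ⁻¹; ϖ, 0] = !![(0 : F), 1; 1, 0] := by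
  ext i j; fin_cases i <;> fin_cases j <;> simp [Matrix.mul_apply, Fin.sum_univ_two, hσϖ, map_inv₀, hϖ]

/-- `J · u(t)` has lower-left entry `1`. [cite: Rogawski1990, §1.10 p. 9] -/
theorem antidiagTwo_mul_lowerUnipTwo_apply_one_zero (t : F) :
    ((!![(0 : F), 1; 1, 0] : Matrix (Fin 2) (Fin 2) F) * !![(1 : F), 0; t, 1]) 1 0 = 1 := by
  simp [Matrix.mul_apply, Fin.sum_univ_two]

/-- `d⁻¹ · !![0,ϖ⁻¹;ϖ,0] · d = J` for `d = diag(1, ϖ)`. [cite: Serre1980Trees, II.1.1] -/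
theorem diagonal_inv_mul_piAntidiagTwo_mul_diagonal {ϖ : F} (hϖ : ϖ ≠ 0) :
    Matrix.diagonal ![(1 : F), ϖ⁻¹] * !![(0 : F), ϖ⁻¹; ϖ, 0] * Matrix.diagonal ![(1 : F), ϖ] = !![(0 : F), 1; 1, 0] := by
  ext i j; fin_cases i <;> fin_cases j <;> simp [Matrix.mul_apply, Fin.sum_univ_two, hϖ]

end OnePlace

section Unramified

variable (L : Type) [Field L] [NumberField L] [IsCMField L] {v : HeightOneSpectrum (𝓞 ↥(maximalRealSubfield L))}
  (w : PlacesOver L v) (hw : IsCMField.complexConj L • w.1 = w.1)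
  (ϖ : (w.1.adicCompletion L)ˣ) (hϖ : Valued.v (ϖ : w.1.adicCompletion L) = WithZero.exp (-1 : ℤ))
  (hσϖ : galAdicCompletionMap (L := L) (IsCMField.complexConj L) hw (ϖ : w.1.adicCompletion L) = ϖ)


/-! ## §1 The witnesses in the explicit triple `K = U(Φ₂)(𝒪_v)`, `K′ = Ad_d K`, `I = K ⊓ K′` -/

/-- (W1) **central unit scalars lie in `K`, `K′ = Ad_d K` and `I = K ⊓ K′`**: a scalar `z = a·1 ∈ U(Φ₂)_v` has `σ_w(a_w) a_w = 1`, so `|a_w|_w = 1` and its one-place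
matrix `a_w·1` is in `GL₂(𝒪_w)` and is fixed by `Ad_d`. [cite: Rogawski1990, §1.10 p. 9] [cite: Serre1980Trees, II.1.1] -/
theorem scalar_mem_triple_of_unramified
    (z : (cmDatum L 2 (Matrix.of fun i j : Fin 2 => if i.val + j.val + 1 = 2 then (1 : L) else 0)).Local v) (a : LocalRing L v)
    (hz : ((z.val : GL (Fin 2) (LocalRing L v)).val : Matrix (Fin 2) (Fin 2) (LocalRing L v)) = a • (1 : Matrix (Fin 2) (Fin 2) (LocalRing L v))) :
    z ∈ cmLocalIntegralLevel L 2 (Matrix.of fun i j : Fin 2 => if i.val + j.val + 1 = 2 then (1 : L) else 0) v ∧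
    z ∈ (cmLocalIntegralLevel L 2 (Matrix.of fun i j : Fin 2 => if i.val + j.val + 1 = 2 then (1 : L) else 0) v).map
        (cmDatumLocalNonsplitCongr L w hw (glDiagonal 2 (w.1.adicCompletion L) ![1, ϖ]) ϖ.isUnit
          (formCongr_glDiagonal_eq_smul_two L w hw ϖ hσϖ)).toMulEquiv.toMonoidHom ∧
    z ∈ cmLocalIntegralLevel L 2 (Matrix.of fun i j : Fin 2 => if i.val + j.val + 1 = 2 then (1 : L) else 0) v ⊓
        (cmLocalIntegralLevel L 2 (Matrix.of fun i j : Fin 2 => if i.val + j.val + 1 = 2 then (1 : L) else 0) v).map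
          (cmDatumLocalNonsplitCongr L w hw (glDiagonal 2 (w.1.adicCompletion L) ![1, ϖ]) ϖ.isUnit
            (formCongr_glDiagonal_eq_smul_two L w hw ϖ hσϖ)).toMulEquiv.toMonoidHom := by
  have hc1 : IsCMField.complexConj L ≠ 1 := IsCMField.complexConj_ne_one L
  have he : (ValuativeRel.valuation (w.1.adicCompletion L)).IsEquiv (Valued.v : Valuation (w.1.adicCompletion L) (WithZero (Multiplicative ℤ))) :=
    ValuativeRel.isEquiv _ _
  have hJ : placeForm (Matrix.of fun i j : Fin 2 => if i.val + j.val + 1 = 2 then (1 : L) else 0) w.1 = !![(0 : w.1.adicCompletion L), 1; 1, 0] := by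
    ext i j; fin_cases i <;> fin_cases j <;> simp [placeForm, Matrix.map_apply]
  set e := localNonsplitEquiv (IsCMField.complexConj L) (Matrix.of fun i j : Fin 2 => if i.val + j.val + 1 = 2 then (1 : L) else 0) hc1 w hw with hedef
  set aw : w.1.adicCompletion L := a w with hawdef
  -- the one-place matrix of `z` is the scalar `a_w`
  have hg : (((e z : ↥(unitaryGroupOfForm (galAdicCompletionMap (L := L) (IsCMField.complexConj L) hw) (placeForm (Matrix.of fun i j : Fin 2 => if i.val + j.val + 1 = 2 then (1 : L) else 0) w.1))) :
      GL (Fin 2) (w.1.adicCompletion L)) : Matrix (Fin 2) (Fin 2) (w.1.adicCompletion L)) = aw • (1 : Matrix (Fin 2) (Fin 2) (w.1.adicCompletion L)) := by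
    change (((z.val : GL (Fin 2) (LocalRing L v)) : Matrix (Fin 2) (Fin 2) (LocalRing L v)).map
      (Pi.evalRingHom (fun w' : PlacesOver L v => w'.1.adicCompletion L) w)) = aw • (1 : Matrix (Fin 2) (Fin 2) (w.1.adicCompletion L))
    rw [hz]; ext i j
    by_cases hij : i = j <;> simp [Matrix.map_apply, hij, hawdef]
  -- unitarity of the scalar: `σ_w(a_w) a_w = 1`, hence `|a_w|_w = 1`
  have hunit := mem_unitaryGroupOfForm_iff.1 (e z).2
  rw [hg, hJ] at hunit
  have hnorm : galAdicCompletionMap (L := L) (IsCMField.complexConj L) hw aw * aw = 1 := by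
    have h01 := congrArg (fun M : Matrix (Fin 2) (Fin 2) (w.1.adicCompletion L) => M 0 1) hunit
    simpa [Matrix.mul_apply, Fin.sum_univ_two, Matrix.map_apply, Matrix.one_apply] using h01
  have hvaw : Valued.v aw = 1 := he.eq_one_iff_eq_one.1 (valuation_eq_one_of_galAdicCompletionMap_mul_self L v w hw hnorm)
  -- scalar unit matrices are in `GL₂(𝒪_w)`
  have hsc : ∀ M : GL (Fin 2) (w.1.adicCompletion L), (M : Matrix (Fin 2) (Fin 2) (w.1.adicCompletion L)) = aw • (1 : Matrix (Fin 2) (Fin 2) (w.1.adicCompletion L)) →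
      M ∈ glInt 2 (w.1.adicCompletion L) := by
    intro M hM
    refine (mem_glInt_iff_forall_v_le_one_and_v_det_eq_one M).2 ⟨fun i j => ?_, ?_⟩
    · rw [hM]; fin_cases i <;> fin_cases j <;> simp [hvaw]
    · rw [hM]; simp [hvaw]
  -- `Ad_d` fixes the scalar
  have hconj : (((glDiagonal 2 (w.1.adicCompletion L) ![1, ϖ])⁻¹ *
      ((e z : ↥(unitaryGroupOfForm (galAdicCompletionMap (L := L) (IsCMField.complexConj L) hw) (placeForm (Matrix.of fun i j : Fin 2 => if i.val + j.val + 1 = 2 then (1 : L) else 0) w.1))) :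
        GL (Fin 2) (w.1.adicCompletion L)) * glDiagonal 2 (w.1.adicCompletion L) ![1, ϖ] : GL (Fin 2) (w.1.adicCompletion L)) : Matrix (Fin 2) (Fin 2) (w.1.adicCompletion L)) =
      aw • (1 : Matrix (Fin 2) (Fin 2) (w.1.adicCompletion L)) := by
    rw [Units.val_mul, Units.val_mul, hg, Matrix.mul_smul, Matrix.mul_one, Matrix.smul_mul, Units.inv_mul]
  have hzK : z ∈ cmLocalIntegralLevel L 2 (Matrix.of fun i j : Fin 2 => if i.val + j.val + 1 = 2 then (1 : L) else 0) v :=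
    (mem_localIntegralLevel_iff_of_smul_eq (IsCMField.complexConj L) 2 _ hc1 w hw z).2 (hsc _ hg)
  have hzK' : z ∈ (cmLocalIntegralLevel L 2 (Matrix.of fun i j : Fin 2 => if i.val + j.val + 1 = 2 then (1 : L) else 0) v).map
      (cmDatumLocalNonsplitCongr L w hw (glDiagonal 2 (w.1.adicCompletion L) ![1, ϖ]) ϖ.isUnit
        (formCongr_glDiagonal_eq_smul_two L w hw ϖ hσϖ)).toMulEquiv.toMonoidHom :=
    (mem_map_cmDatumLocalNonsplitCongr_cmLocalIntegralLevel_iff L w hw ϖ hσϖ z).2 ((Literature.GroupTheory.mem_map_conj_iff _ _ _).2 (hsc _ hconj))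
  exact ⟨hzK, hzK', Subgroup.mem_inf.2 ⟨hzK, hzK'⟩⟩


set_option maxHeartbeats 800000 in  -- HB: three one-place GL₂ elements are transported along `localNonsplitEquiv` in one declaration
include hw hϖ hσϖ in
/-- (W2)+(W3) **the coset witnesses at an unramified place**: `k₂ = w₀` (matrix `Φ₂`), `k₃ =` the lower unipotent `!![1,0;t,1]` with `σt = −t`, `|t| = 1`
(exists since `w ∣ v` is inert), both in `K` and outside the Iwahori `I`, with `w₀⁻¹ k₃ ∉ I`; and `x` with one-place matrix `!![0,ϖ⁻¹;ϖ,0]`, in `K′ = Ad_d K` but not in `K`.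
[cite: Serre1980Trees, II.1.1] [cite: Kottwitz1988, §2] -/
theorem exists_epTripleWitnesses_of_unramified (hunr : Algebra.IsUnramifiedIn (𝓞 L) v.asIdeal) :
    ∃ k₂ k₃ x : (cmDatum L 2 (Matrix.of fun i j : Fin 2 => if i.val + j.val + 1 = 2 then (1 : L) else 0)).Local v,
      k₂ ∈ cmLocalIntegralLevel L 2 (Matrix.of fun i j : Fin 2 => if i.val + j.val + 1 = 2 then (1 : L) else 0) v ∧ k₃ ∈ cmLocalIntegralLevel L 2 (Matrix.of fun i j : Fin 2 => if i.val + j.val + 1 = 2 then (1 : L) else 0) v ∧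
      k₂ ∉ cmLocalIntegralLevel L 2 (Matrix.of fun i j : Fin 2 => if i.val + j.val + 1 = 2 then (1 : L) else 0) v ⊓
        (cmLocalIntegralLevel L 2 (Matrix.of fun i j : Fin 2 => if i.val + j.val + 1 = 2 then (1 : L) else 0) v).map
        (cmDatumLocalNonsplitCongr L w hw (glDiagonal 2 (w.1.adicCompletion L) ![1, ϖ]) ϖ.isUnit
          (formCongr_glDiagonal_eq_smul_two L w hw ϖ hσϖ)).toMulEquiv.toMonoidHom ∧
      k₃ ∉ cmLocalIntegralLevel L 2 (Matrix.of fun i j : Fin 2 => if i.val + j.val + 1 = 2 then (1 : L) else 0) v ⊓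
        (cmLocalIntegralLevel L 2 (Matrix.of fun i j : Fin 2 => if i.val + j.val + 1 = 2 then (1 : L) else 0) v).map
        (cmDatumLocalNonsplitCongr L w hw (glDiagonal 2 (w.1.adicCompletion L) ![1, ϖ]) ϖ.isUnit
          (formCongr_glDiagonal_eq_smul_two L w hw ϖ hσϖ)).toMulEquiv.toMonoidHom ∧
      k₂⁻¹ * k₃ ∉ cmLocalIntegralLevel L 2 (Matrix.of fun i j : Fin 2 => if i.val + j.val + 1 = 2 then (1 : L) else 0) v ⊓
        (cmLocalIntegralLevel L 2 (Matrix.of fun i j : Fin 2 => if i.val + j.val + 1 = 2 then (1 : L) else 0) v).map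
        (cmDatumLocalNonsplitCongr L w hw (glDiagonal 2 (w.1.adicCompletion L) ![1, ϖ]) ϖ.isUnit
          (formCongr_glDiagonal_eq_smul_two L w hw ϖ hσϖ)).toMulEquiv.toMonoidHom ∧
      x ∈ (cmLocalIntegralLevel L 2 (Matrix.of fun i j : Fin 2 => if i.val + j.val + 1 = 2 then (1 : L) else 0) v).map
        (cmDatumLocalNonsplitCongr L w hw (glDiagonal 2 (w.1.adicCompletion L) ![1, ϖ]) ϖ.isUnit
          (formCongr_glDiagonal_eq_smul_two L w hw ϖ hσϖ)).toMulEquiv.toMonoidHom ∧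
      x ∉ cmLocalIntegralLevel L 2 (Matrix.of fun i j : Fin 2 => if i.val + j.val + 1 = 2 then (1 : L) else 0) v := by
  classical
  have hc1 : IsCMField.complexConj L ≠ 1 := IsCMField.complexConj_ne_one L
  haveI : Subsingleton (PlacesOver L v) := PlacesOver.subsingleton_of_smul_eq (IsCMField.complexConj L) hc1 w hw
  -- the valuations on `L_w`
  have he : (ValuativeRel.valuation (w.1.adicCompletion L)).IsEquiv (Valued.v : Valuation (w.1.adicCompletion L) (WithZero (Multiplicative ℤ))) :=
    ValuativeRel.isEquiv _ _
  have hϖ0 : (ϖ : w.1.adicCompletion L) ≠ 0 := ϖ.ne_zero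
  have hvϖinv : ¬ Valued.v ((ϖ : w.1.adicCompletion L)⁻¹) ≤ 1 := by
    rw [map_inv₀, hϖ, ← WithZero.exp_neg, ← WithZero.exp_zero, not_le]
    exact WithZero.exp_lt_exp.2 (by norm_num)
  -- the form at `w`
  have hJ : placeForm (Matrix.of fun i j : Fin 2 => if i.val + j.val + 1 = 2 then (1 : L) else 0) w.1 = !![(0 : w.1.adicCompletion L), 1; 1, 0] := by
    ext i j; fin_cases i <;> fin_cases j <;> simp [placeForm, Matrix.map_apply]
  -- an anti-fixed unit `t` (the place is inert): `t := σ a₀ − a₀` with `a₀` moved by the residual Frobenius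
  have hσO : ∀ y : 𝒪[w.1.adicCompletion L], galAdicCompletionMap (L := L) (IsCMField.complexConj L) hw y ∈ 𝒪[w.1.adicCompletion L] :=
    mem_integer_galAdicCompletionMap (IsCMField.complexConj L) v w hw
  obtain ⟨σk, hσk⟩ := exists_residueField_ringHom_galAdicCompletionMap (IsCMField.complexConj L) v w hw
  letI : Fintype 𝓀[w.1.adicCompletion L] := Fintype.ofFinite _
  have hq' : Fintype.card 𝓀[w.1.adicCompletion L] = Nat.card (𝓞 ↥(maximalRealSubfield L) ⧸ v.asIdeal) ^ 2 := by
    rw [← Nat.card_eq_fintype_card]; exact natCard_residueField_eq_sq_of_inert (IsCMField.complexConj L) v hc1 hunr w hw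
  obtain ⟨a₀, ha₀⟩ := LocalFields.UnramifiedQuadraticNorm.exists_isUnit_map_sub_of_residueHom_ne
    (galAdicCompletionMap (L := L) (IsCMField.complexConj L) hw) hσO σk hσk
    (Literature.LinearAlgebra.Matrix.exists_frob_ne hq' σk (residueHom_galAdicCompletionMap_eq_pow (IsCMField.complexConj L) v hc1 hunr w hw σk hσO hσk))
  set t : w.1.adicCompletion L := galAdicCompletionMap (L := L) (IsCMField.complexConj L) hw (a₀ : w.1.adicCompletion L) - (a₀ : w.1.adicCompletion L) with htdef
  have hσt : galAdicCompletionMap (L := L) (IsCMField.complexConj L) hw t = -t := by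
    rw [htdef, map_sub, galAdicCompletionMap_galAdicCompletionMap_of_smul_eq (IsCMField.complexConj L) w hc1 hw]; ring
  have hvt : Valued.v t = 1 := by
    have h1 : ValuativeRel.valuation (w.1.adicCompletion L) t = 1 := by
      have h := (Valuation.Integers.isUnit_iff_valuation_eq_one
        (Valuation.integer.integers (ValuativeRel.valuation (w.1.adicCompletion L)))).1 ha₀
      have hcoe : (algebraMap (↥(ValuativeRel.valuation (w.1.adicCompletion L)).integer) (w.1.adicCompletion L))
          ((⟨galAdicCompletionMap (L := L) (IsCMField.complexConj L) hw (a₀ : w.1.adicCompletion L), hσO a₀⟩ : 𝒪[w.1.adicCompletion L]) - a₀) = t := by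
        rw [map_sub, htdef]; rfl
      rwa [hcoe] at h
    exact he.eq_one_iff_eq_one.1 h1
  -- the three one-place matrices and their inverses
  have hJJ := antidiagTwo_mul_self (F := w.1.adicCompletion L)
  have hUU := lowerUnipTwo_mul_neg t
  have hUU' : (!![(1 : w.1.adicCompletion L), 0; -t, 1] : Matrix (Fin 2) (Fin 2) (w.1.adicCompletion L)) * !![(1 : w.1.adicCompletion L), 0; t, 1] = 1 := by
    simpa using lowerUnipTwo_mul_neg (-t)
  have hXX := piAntidiagTwo_mul_self hϖ0
  set G₂ : GL (Fin 2) (w.1.adicCompletion L) := ⟨_, _, hJJ, hJJ⟩ with hG₂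
  set G₃ : GL (Fin 2) (w.1.adicCompletion L) := ⟨_, _, hUU, hUU'⟩ with hG₃
  set Gx : GL (Fin 2) (w.1.adicCompletion L) := ⟨_, _, hXX, hXX⟩ with hGx
  -- unitarity for `σ_w` and the form `!![0,1;1,0]`
  have hmemU : ∀ g : GL (Fin 2) (w.1.adicCompletion L),
      ((g : Matrix (Fin 2) (Fin 2) (w.1.adicCompletion L)).map (galAdicCompletionMap (L := L) (IsCMField.complexConj L) hw))ᵀ *
          !![(0 : w.1.adicCompletion L), 1; 1, 0] * (g : Matrix (Fin 2) (Fin 2) (w.1.adicCompletion L)) = !![(0 : w.1.adicCompletion L), 1; 1, 0] →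
        g ∈ unitaryGroupOfForm (galAdicCompletionMap (L := L) (IsCMField.complexConj L) hw) (placeForm (Matrix.of fun i j : Fin 2 => if i.val + j.val + 1 = 2 then (1 : L) else 0) w.1) := by
    intro g hg; rw [mem_unitaryGroupOfForm_iff, hJ]; exact hg
  have hU₂ : G₂ ∈ unitaryGroupOfForm (galAdicCompletionMap (L := L) (IsCMField.complexConj L) hw) (placeForm (Matrix.of fun i j : Fin 2 => if i.val + j.val + 1 = 2 then (1 : L) else 0) w.1) :=
    hmemU G₂ (antidiagTwo_unitary _)
  have hU₃ : G₃ ∈ unitaryGroupOfForm (galAdicCompletionMap (L := L) (IsCMField.complexConj L) hw) (placeForm (Matrix.of fun i j : Fin 2 => if i.val + j.val + 1 = 2 then (1 : L) else 0) w.1) :=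
    hmemU G₃ (lowerUnipTwo_unitary _ hσt)
  have hUx : Gx ∈ unitaryGroupOfForm (galAdicCompletionMap (L := L) (IsCMField.complexConj L) hw) (placeForm (Matrix.of fun i j : Fin 2 => if i.val + j.val + 1 = 2 then (1 : L) else 0) w.1) :=
    hmemU Gx (piAntidiagTwo_unitary _ hϖ0 hσϖ)
  -- integrality ∕ Iwahori readings of the three matrices
  have hint₂ : G₂ ∈ glInt 2 (w.1.adicCompletion L) := by
    refine (mem_glInt_iff_forall_v_le_one_and_v_det_eq_one G₂).2 ⟨fun i j => ?_, ?_⟩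
    · change Valued.v ((!![(0 : w.1.adicCompletion L), 1; 1, 0] : Matrix _ _ _) i j) ≤ 1
      fin_cases i <;> fin_cases j <;> simp
    · change Valued.v ((!![(0 : w.1.adicCompletion L), 1; 1, 0] : Matrix _ _ _).det) = 1
      simp [Matrix.det_fin_two]
  have hint₃ : G₃ ∈ glInt 2 (w.1.adicCompletion L) := by
    refine (mem_glInt_iff_forall_v_le_one_and_v_det_eq_one G₃).2 ⟨fun i j => ?_, ?_⟩
    · change Valued.v ((!![(1 : w.1.adicCompletion L), 0; t, 1] : Matrix _ _ _) i j) ≤ 1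
      fin_cases i <;> fin_cases j <;> simp [hvt.le]
    · change Valued.v ((!![(1 : w.1.adicCompletion L), 0; t, 1] : Matrix _ _ _).det) = 1
      simp [Matrix.det_fin_two]
  have hnotIw : ∀ g : GL (Fin 2) (w.1.adicCompletion L), Valued.v ((g : Matrix (Fin 2) (Fin 2) (w.1.adicCompletion L)) 1 0) = 1 →
      g ∉ iwahoriGL 2 (w.1.adicCompletion L) := by
    intro g hg h
    have h10 := ((mem_iwahoriGL_iff g).1 h).2 1 0 (by decide)
    rw [he.lt_one_iff_lt_one, hg] at h10
    exact lt_irrefl _ h10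
  have hnI₂ : G₂ ∉ iwahoriGL 2 (w.1.adicCompletion L) := hnotIw G₂ (by change Valued.v ((!![(0 : w.1.adicCompletion L), 1; 1, 0] : Matrix _ _ _) 1 0) = 1; simp)
  have hnI₃ : G₃ ∉ iwahoriGL 2 (w.1.adicCompletion L) := hnotIw G₃ (by change Valued.v ((!![(1 : w.1.adicCompletion L), 0; t, 1] : Matrix _ _ _) 1 0) = 1; simpa using hvt)
  have hnI₂₃ : G₂⁻¹ * G₃ ∉ iwahoriGL 2 (w.1.adicCompletion L) := by
    apply hnotIw
    rw [Units.val_mul]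
    change Valued.v (((!![(0 : w.1.adicCompletion L), 1; 1, 0] : Matrix _ _ _) * !![(1 : w.1.adicCompletion L), 0; t, 1]) 1 0) = 1
    rw [antidiagTwo_mul_lowerUnipTwo_apply_one_zero, map_one]
  have hnKx : Gx ∉ glInt 2 (w.1.adicCompletion L) := by
    intro h
    have h01 := ((mem_glInt_iff_forall_v_le_one_and_v_det_eq_one Gx).1 h).1 0 1
    exact hvϖinv (by simpa [hGx] using h01)
  have hKx' : (glDiagonal 2 (w.1.adicCompletion L) ![1, ϖ])⁻¹ * Gx * glDiagonal 2 (w.1.adicCompletion L) ![1, ϖ] ∈ glInt 2 (w.1.adicCompletion L) := by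
    have hmat : (((glDiagonal 2 (w.1.adicCompletion L) ![1, ϖ])⁻¹ * Gx * glDiagonal 2 (w.1.adicCompletion L) ![1, ϖ] : GL (Fin 2) (w.1.adicCompletion L)) :
        Matrix (Fin 2) (Fin 2) (w.1.adicCompletion L)) = !![(0 : w.1.adicCompletion L), 1; 1, 0] := by
      rw [Units.val_mul, Units.val_mul, ← map_inv, coe_glDiagonal, coe_glDiagonal]
      have hd1 : (fun k : Fin 2 => (((![1, ϖ] : Fin 2 → (w.1.adicCompletion L)ˣ)⁻¹ k : (w.1.adicCompletion L)ˣ) : w.1.adicCompletion L)) = ![(1 : w.1.adicCompletion L), (ϖ : w.1.adicCompletion L)⁻¹] := by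
        funext k; fin_cases k <;> simp
      have hd2 : (fun k : Fin 2 => (((![1, ϖ] : Fin 2 → (w.1.adicCompletion L)ˣ) k : (w.1.adicCompletion L)ˣ) : w.1.adicCompletion L)) = ![(1 : w.1.adicCompletion L), (ϖ : w.1.adicCompletion L)] := by
        funext k; fin_cases k <;> simp
      rw [hd1, hd2]
      exact diagonal_inv_mul_piAntidiagTwo_mul_diagonal hϖ0
    refine (mem_glInt_iff_forall_v_le_one_and_v_det_eq_one _).2 ⟨fun i j => ?_, ?_⟩
    · rw [hmat]; fin_cases i <;> fin_cases j <;> simp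
    · rw [hmat]; simp [Matrix.det_fin_two]
  -- transport to `U₂ = U(Φ₂)(L⁺_v)` along the one-place model
  set e := localNonsplitEquiv (IsCMField.complexConj L) (Matrix.of fun i j : Fin 2 => if i.val + j.val + 1 = 2 then (1 : L) else 0) hc1 w hw with hedef
  -- the three membership criteria through the one-place model
  have hK : ∀ u : (cmDatum L 2 (Matrix.of fun i j : Fin 2 => if i.val + j.val + 1 = 2 then (1 : L) else 0)).Local v, u ∈ cmLocalIntegralLevel L 2 (Matrix.of fun i j : Fin 2 => if i.val + j.val + 1 = 2 then (1 : L) else 0) v ↔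
      ((e u : ↥(unitaryGroupOfForm (galAdicCompletionMap (L := L) (IsCMField.complexConj L) hw) (placeForm (Matrix.of fun i j : Fin 2 => if i.val + j.val + 1 = 2 then (1 : L) else 0) w.1))) :
        GL (Fin 2) (w.1.adicCompletion L)) ∈ glInt 2 (w.1.adicCompletion L) :=
    fun u => mem_localIntegralLevel_iff_of_smul_eq (IsCMField.complexConj L) 2 _ hc1 w hw u
  have hI : ∀ u : (cmDatum L 2 (Matrix.of fun i j : Fin 2 => if i.val + j.val + 1 = 2 then (1 : L) else 0)).Local v, u ∈ cmLocalIntegralLevel L 2 (Matrix.of fun i j : Fin 2 => if i.val + j.val + 1 = 2 then (1 : L) else 0) v ⊓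
      (cmLocalIntegralLevel L 2 (Matrix.of fun i j : Fin 2 => if i.val + j.val + 1 = 2 then (1 : L) else 0) v).map
        (cmDatumLocalNonsplitCongr L w hw (glDiagonal 2 (w.1.adicCompletion L) ![1, ϖ]) ϖ.isUnit
          (formCongr_glDiagonal_eq_smul_two L w hw ϖ hσϖ)).toMulEquiv.toMonoidHom ↔
      ((e u : ↥(unitaryGroupOfForm (galAdicCompletionMap (L := L) (IsCMField.complexConj L) hw) (placeForm (Matrix.of fun i j : Fin 2 => if i.val + j.val + 1 = 2 then (1 : L) else 0) w.1))) :
        GL (Fin 2) (w.1.adicCompletion L)) ∈ iwahoriGL 2 (w.1.adicCompletion L) :=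
    fun u => mem_cmLocalIntegralLevel_inf_map_iff L w hw ϖ hϖ hσϖ u
  have hK' : ∀ u : (cmDatum L 2 (Matrix.of fun i j : Fin 2 => if i.val + j.val + 1 = 2 then (1 : L) else 0)).Local v, u ∈ (cmLocalIntegralLevel L 2 (Matrix.of fun i j : Fin 2 => if i.val + j.val + 1 = 2 then (1 : L) else 0) v).map
        (cmDatumLocalNonsplitCongr L w hw (glDiagonal 2 (w.1.adicCompletion L) ![1, ϖ]) ϖ.isUnit
          (formCongr_glDiagonal_eq_smul_two L w hw ϖ hσϖ)).toMulEquiv.toMonoidHom ↔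
      ((e u : ↥(unitaryGroupOfForm (galAdicCompletionMap (L := L) (IsCMField.complexConj L) hw) (placeForm (Matrix.of fun i j : Fin 2 => if i.val + j.val + 1 = 2 then (1 : L) else 0) w.1))) :
        GL (Fin 2) (w.1.adicCompletion L)) ∈
        (glInt 2 (w.1.adicCompletion L)).map (MulAut.conj (glDiagonal 2 (w.1.adicCompletion L) ![1, ϖ])).toMonoidHom :=
    fun u => mem_map_cmDatumLocalNonsplitCongr_cmLocalIntegralLevel_iff L w hw ϖ hσϖ u
  have hquot : ((e ((e.symm ⟨G₂, hU₂⟩)⁻¹ * e.symm ⟨G₃, hU₃⟩) :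
      ↥(unitaryGroupOfForm (galAdicCompletionMap (L := L) (IsCMField.complexConj L) hw) (placeForm (Matrix.of fun i j : Fin 2 => if i.val + j.val + 1 = 2 then (1 : L) else 0) w.1))) :
        GL (Fin 2) (w.1.adicCompletion L)) = G₂⁻¹ * G₃ := by
    rw [map_mul, map_inv, e.apply_symm_apply, e.apply_symm_apply, Subgroup.coe_mul, Subgroup.coe_inv]
  refine ⟨(e.symm ⟨G₂, hU₂⟩ : (cmDatum L 2 (Matrix.of fun i j : Fin 2 => if i.val + j.val + 1 = 2 then (1 : L) else 0)).Local v), (e.symm ⟨G₃, hU₃⟩ : (cmDatum L 2 (Matrix.of fun i j : Fin 2 => if i.val + j.val + 1 = 2 then (1 : L) else 0)).Local v), (e.symm ⟨Gx, hUx⟩ : (cmDatum L 2 (Matrix.of fun i j : Fin 2 => if i.val + j.val + 1 = 2 then (1 : L) else 0)).Local v), ?_, ?_, ?_, ?_, ?_, ?_, ?_⟩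
  · rw [hK, e.apply_symm_apply]; exact hint₂
  · rw [hK, e.apply_symm_apply]; exact hint₃
  · rw [hI, e.apply_symm_apply]; exact hnI₂
  · rw [hI, e.apply_symm_apply]; exact hnI₃
  · rw [hI]; exact fun h => hnI₂₃ (by rw [← hquot]; exact h)
  · rw [hK', e.apply_symm_apply, Literature.GroupTheory.mem_map_conj_iff]; exact hKx'
  · rw [hK, e.apply_symm_apply]; exact hnKx

variable
  [MeasurableSpace ((cmDatum L 2 (Matrix.of fun i j : Fin 2 => if i.val + j.val + 1 = 2 then (1 : L) else 0)).Local v)]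
  [BorelSpace ((cmDatum L 2 (Matrix.of fun i j : Fin 2 => if i.val + j.val + 1 = 2 then (1 : L) else 0)).Local v)]
  [∀ γ : (cmDatum L 2 (Matrix.of fun i j : Fin 2 => if i.val + j.val + 1 = 2 then (1 : L) else 0)).Local v,
    MeasurableSpace (((cmDatum L 2 (Matrix.of fun i j : Fin 2 => if i.val + j.val + 1 = 2 then (1 : L) else 0)).Local v) ⧸
      Subgroup.centralizer ({γ} : Set ((cmDatum L 2 (Matrix.of fun i j : Fin 2 => if i.val + j.val + 1 = 2 then (1 : L) else 0)).Local v)))]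
  [∀ γ : (cmDatum L 2 (Matrix.of fun i j : Fin 2 => if i.val + j.val + 1 = 2 then (1 : L) else 0)).Local v,
    BorelSpace (((cmDatum L 2 (Matrix.of fun i j : Fin 2 => if i.val + j.val + 1 = 2 then (1 : L) else 0)).Local v) ⧸
      Subgroup.centralizer ({γ} : Set ((cmDatum L 2 (Matrix.of fun i j : Fin 2 => if i.val + j.val + 1 = 2 then (1 : L) else 0)).Local v)))]
  (ν : Measure ((cmDatum L 2 (Matrix.of fun i j : Fin 2 => if i.val + j.val + 1 = 2 then (1 : L) else 0)).Local v))
  [IsHaarMeasure ν] [ν.IsMulRightInvariant]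

omit [ν.IsMulRightInvariant]
  [∀ γ : (cmDatum L 2 (Matrix.of fun i j : Fin 2 => if i.val + j.val + 1 = 2 then (1 : L) else 0)).Local v,
    MeasurableSpace (((cmDatum L 2 (Matrix.of fun i j : Fin 2 => if i.val + j.val + 1 = 2 then (1 : L) else 0)).Local v) ⧸
      Subgroup.centralizer ({γ} : Set ((cmDatum L 2 (Matrix.of fun i j : Fin 2 => if i.val + j.val + 1 = 2 then (1 : L) else 0)).Local v)))]
  [∀ γ : (cmDatum L 2 (Matrix.of fun i j : Fin 2 => if i.val + j.val + 1 = 2 then (1 : L) else 0)).Local v,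
    BorelSpace (((cmDatum L 2 (Matrix.of fun i j : Fin 2 => if i.val + j.val + 1 = 2 then (1 : L) else 0)).Local v) ⧸
      Subgroup.centralizer ({γ} : Set ((cmDatum L 2 (Matrix.of fun i j : Fin 2 => if i.val + j.val + 1 = 2 then (1 : L) else 0)).Local v)))] in
include hw hϖ hσϖ in
/-- (W2)+(W3) the coset witnesses ⇒ the index inequality `1∕vol K + 1∕vol K′ < 1∕vol I` (`[K:I] = q+1 ≥ 3`, `[K′:I] ≥ 2`). [cite: Serre1980Trees, II.1.1] [cite: Kottwitz1988, §2] -/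
theorem toReal_inv_add_toReal_inv_lt_of_unramified (hunr : Algebra.IsUnramifiedIn (𝓞 L) v.asIdeal) :
    (ν (cmLocalIntegralLevel L 2 (Matrix.of fun i j : Fin 2 => if i.val + j.val + 1 = 2 then (1 : L) else 0) v :
        Set ((cmDatum L 2 (Matrix.of fun i j : Fin 2 => if i.val + j.val + 1 = 2 then (1 : L) else 0)).Local v))).toReal⁻¹ +
      (ν ((cmLocalIntegralLevel L 2 (Matrix.of fun i j : Fin 2 => if i.val + j.val + 1 = 2 then (1 : L) else 0) v).map
        (cmDatumLocalNonsplitCongr L w hw (glDiagonal 2 (w.1.adicCompletion L) ![1, ϖ]) ϖ.isUnit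
          (formCongr_glDiagonal_eq_smul_two L w hw ϖ hσϖ)).toMulEquiv.toMonoidHom :
        Set ((cmDatum L 2 (Matrix.of fun i j : Fin 2 => if i.val + j.val + 1 = 2 then (1 : L) else 0)).Local v))).toReal⁻¹ <
      (ν (cmLocalIntegralLevel L 2 (Matrix.of fun i j : Fin 2 => if i.val + j.val + 1 = 2 then (1 : L) else 0) v ⊓
        (cmLocalIntegralLevel L 2 (Matrix.of fun i j : Fin 2 => if i.val + j.val + 1 = 2 then (1 : L) else 0) v).map
          (cmDatumLocalNonsplitCongr L w hw (glDiagonal 2 (w.1.adicCompletion L) ![1, ϖ]) ϖ.isUnit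
            (formCongr_glDiagonal_eq_smul_two L w hw ϖ hσϖ)).toMulEquiv.toMonoidHom :
        Set ((cmDatum L 2 (Matrix.of fun i j : Fin 2 => if i.val + j.val + 1 = 2 then (1 : L) else 0)).Local v))).toReal⁻¹ := by
  obtain ⟨hKc, hKo⟩ := isCompact_isOpen_cmLocalIntegralLevel L 2 (Matrix.of fun i j : Fin 2 => if i.val + j.val + 1 = 2 then (1 : L) else 0) v
  obtain ⟨hK'c, -⟩ := isCompact_isOpen_map_cmDatumLocalNonsplitCongr_cmLocalIntegralLevel L w hw ϖ hσϖ
  obtain ⟨-, hIo⟩ := isCompact_isOpen_cmLocalIntegralLevel_inf_map L w hw ϖ hσϖ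
  obtain ⟨k₂, k₃, x, hk₂, hk₃, hnI₂, hnI₃, hnI₂₃, hx, hnKx⟩ := exists_epTripleWitnesses_of_unramified L w hw ϖ hϖ hσϖ hunr
  refine toReal_inv_add_toReal_inv_lt_of_witnesses ν inf_le_left inf_le_right hIo.measurableSet (hIo.measure_pos ν ⟨1, Subgroup.one_mem _⟩)
    hKc.measure_lt_top hK'c.measure_lt_top (Subgroup.one_mem _) hk₂ hk₃ ?_ ?_ hnI₂₃ hx fun h => hnKx (Subgroup.mem_inf.1 h).1
  · rwa [inv_one, one_mul]
  · rwa [inv_one, one_mul]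

/-! ## §2 The letter with its negative central value at an unramified place -/

include hw hϖ hσϖ in
/-- **(R2♯) AT AN UNRAMIFIED NON-SPLIT PLACE.**  For `v` inert in `L` and canonical orbital measures on `U(Φ₂)_v` there is a locally constant compactly supported `f`
(Kottwitz's Euler–Poincaré function) with orbital integral `1` on every regular elliptic class, `0` on every regular split class, and the SAME NEGATIVE VALUE
`f(a·1) = −r`, `r > 0`, at every central unit scalar. [cite: Kottwitz1988, §2] [cite: Rogawski1990, §12.6 p. 174] -/
theorem exists_isLocSmooth_classOrbitalIntegral_eq_one_zero_and_apply_neg_of_unramified (hunr : Algebra.IsUnramifiedIn (𝓞 L) v.asIdeal)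
    {m : OrbitalMeasureFamily ((cmDatum L 2 (Matrix.of fun i j : Fin 2 => if i.val + j.val + 1 = 2 then (1 : L) else 0)).Local v)}
    (hm : m.IsCanonical (fun γ => IsRegularElt (γ.val : GL (Fin 2) (UnitaryGroup.LocalRing L v))) ν) :
    ∃ f : (cmDatum L 2 (Matrix.of fun i j : Fin 2 => if i.val + j.val + 1 = 2 then (1 : L) else 0)).Local v → ℂ, IsLocSmooth f ∧
      (∀ γ : (cmDatum L 2 (Matrix.of fun i j : Fin 2 => if i.val + j.val + 1 = 2 then (1 : L) else 0)).Local v,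
          IsRegularElt (γ.val : GL (Fin 2) (UnitaryGroup.LocalRing L v)) →
          CompactSpace (Subgroup.centralizer ({γ} : Set ((cmDatum L 2 (Matrix.of fun i j : Fin 2 => if i.val + j.val + 1 = 2 then (1 : L) else 0)).Local v))) →
          classOrbitalIntegral m f (ConjClasses.mk γ) = 1) ∧
      (∀ γ : (cmDatum L 2 (Matrix.of fun i j : Fin 2 => if i.val + j.val + 1 = 2 then (1 : L) else 0)).Local v,
          IsRegularElt (γ.val : GL (Fin 2) (UnitaryGroup.LocalRing L v)) →
          ¬ CompactSpace (Subgroup.centralizer ({γ} : Set ((cmDatum L 2 (Matrix.of fun i j : Fin 2 => if i.val + j.val + 1 = 2 then (1 : L) else 0)).Local v))) →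
          classOrbitalIntegral m f (ConjClasses.mk γ) = 0) ∧
      ∃ r : ℝ, 0 < r ∧ ∀ (z : (cmDatum L 2 (Matrix.of fun i j : Fin 2 => if i.val + j.val + 1 = 2 then (1 : L) else 0)).Local v) (a : LocalRing L v),
          ((z.val : GL (Fin 2) (LocalRing L v)).val : Matrix (Fin 2) (Fin 2) (LocalRing L v)) = a • (1 : Matrix (Fin 2) (Fin 2) (LocalRing L v)) →
          f z = -(r : ℂ) := by
  obtain ⟨hKc, hKo⟩ := isCompact_isOpen_cmLocalIntegralLevel L 2 (Matrix.of fun i j : Fin 2 => if i.val + j.val + 1 = 2 then (1 : L) else 0) v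
  obtain ⟨hK'c, hK'o⟩ := isCompact_isOpen_map_cmDatumLocalNonsplitCongr_cmLocalIntegralLevel L w hw ϖ hσϖ
  obtain ⟨hIc, hIo⟩ := isCompact_isOpen_cmLocalIntegralLevel_inf_map L w hw ϖ hσϖ
  obtain ⟨f, hf, h1, h0, r, hr, hval⟩ :=
    exists_isLocSmooth_classOrbitalIntegral_eq_one_zero_and_apply_neg_of_relations L 2 _ v ν
      (UnitaryGroup.antidiagOne_isHermitian L 2) (UnitaryGroup.isUnit_antidiagOne_det L 2).ne_zero hm _ _ _ hKo hKc hK'o hK'c hIo hIc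
      (epEllipticRelation_of_unramified L w hw ϖ hϖ hσϖ hunr) (epNonEllipticRelation L w hw ϖ hϖ hσϖ ν hm)
      (toReal_inv_add_toReal_inv_lt_of_unramified L w hw ϖ hϖ hσϖ ν hunr)
  refine ⟨f, hf, h1, h0, r, hr, fun z a hz => ?_⟩
  obtain ⟨hzK, hzK', hzI⟩ := scalar_mem_triple_of_unramified L w hw ϖ hσϖ z a hz
  exact hval z hzK hzK' hzI

end Unramified

end Literature.NumberTheory.Rogawski1990

end
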